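/-
Copyright (c) 2026. All rights reserved.
Released under Apache 2.0 license as described in the file LICENSE.
Authors: HodgeCM publication cell (pub-hodgecm), model-construction sub-cell, construction prover `mc-weil-1`.
-/
import Literature.RepresentationTheory.HeisenbergGroup.LocalWeilProjective
import Literature.GroupTheory.CocycleCentralExtension

/-!
# Sections of implementers, their cocycles, and the Weil representation of the twisted product (any rank)

Topic `RepresentationTheory/HeisenbergGroup`; namespace `Literature.RepresentationTheory.HeisenbergGroup`.

General rank, any model `ρ` of the Heisenberg group of `(V, B)` on a `k`-vector space `S ≠ 0` (`k` a field):

* §1 `ImplementerSection ρ`: a NORMALISED SECTION `r : Sp(V,B) → GL(S)` of implementers — `r(g)` satisfies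
  condition (A) for `g` and `r(1) = 1`. One exists as soon as implementers exist (`ImplementerSection.ofExists`, from
  the predicate `ExistsImplementer ρ` of `LocalWeilProjective`).
* §2 under UNIQUENESS UP TO SCALARS (`hU : ImplementerUniqueUpToScalar ρ`, the second predicate of
  `LocalWeilProjective`; both predicates are THEOREMS in rank one — `RankOneGeneration`, `SchrodingerCommutant`):
  `r(g) r(g') = c_r(g,g') · r(gg')` for a unique unit `c_r(g,g')` (`ImplementerSection.mul_apply`), and
  **`c_r` is a normalised central 2-cocycle** (`ImplementerSection.cocycle : CentralCocycle Sp(V,B) kˣ`, tree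
  structure; the cocycle identity is associativity of composition), with `c_r(1,g) = c_r(g,1) = 1`;
* §3 in the tree's operator vocabulary (`Literature.GroupTheory.TwistedProduct`): `HasMultiplier c_r z r`
  (`z = unitScalar k S : kˣ →* End_k(S)`, `a ↦ a·1`), scalars commute with `r`, hence **the Weil representation of the
  twisted product** `weilOp r hU : Sp(V,B) ×_{c_r} kˣ →* End_k(S)`, `(g,a) ↦ a · r(g)` (tree `TwistedProduct.opHom`),
  and `implementer_eq_of_apply_eq` (two implementers of `g` agreeing on a vector not killed are equal).

This is the local datum (`r_v`, `c_v`, `h1`, `hz`, `hr`) a restricted tensor product `⊗'_v ω_v` consumes at each place,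
for ANY rank, modulo the two predicates; nothing is cited.
-/

set_option autoImplicit false

noncomputable section

namespace Literature.RepresentationTheory.HeisenbergGroup

open Literature.GroupTheory

universe u v u' v'

/-! ## §0 Scalars as endomorphisms -/

section Scalars

variable (k : Type u') [CommRing k] (S : Type v') [AddCommGroup S] [Module k S]

/-- the scalars `kˣ → End_k(S)`, `a ↦ a • 1`. [folklore] -/
def unitScalar : kˣ →* Module.End k S :=
  (algebraMap k (Module.End k S) : k →* Module.End k S).comp (Units.coeHom k)

/-- `unitScalar a v = a • v`. [folklore] -/
theorem unitScalar_apply (a : kˣ) (v : S) : unitScalar k S a v = (a : k) • v := rfl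

/-- scalars commute with every linear map. [folklore] -/
theorem commute_unitScalar (a : kˣ) (T : Module.End k S) : Commute (unitScalar k S a) T := by
  refine LinearMap.ext fun v => ?_
  rw [Module.End.mul_apply, Module.End.mul_apply, unitScalar_apply, unitScalar_apply, map_smul]

end Scalars

variable {R : Type u} [CommRing R] [Invertible (2 : R)] {V : Type v} [AddCommGroup V] [Module R V]
  {B : V →ₗ[R] V →ₗ[R] R}
variable {k : Type u'} [Field k] {S : Type v'} [AddCommGroup S] [Module k S]
variable (ρ : Representation k (Heisenberg B) S)

/-! ## §1 Normalised sections of implementers -/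

/-- a **normalised section of implementers** of the model `ρ`: `r : Sp(V,B) → GL(S)` with `r(g)` implementing `g`
(condition (A) of MVW Chap. 2 II.1) and `r(1) = 1`. [cite: MoeglinVignerasWaldspurger1987, Chap. 2 II.1 (A)] -/
structure ImplementerSection where
  /-- the operators `r(g)` -/
  toFun : symplecticGroup B → (S ≃ₗ[k] S)
  /-- `r(g)` implements `g` -/
  implements' : ∀ g, Implements ρ (ofSymplectic B g) (toFun g)
  /-- normalisation `r(1) = 1` -/
  map_one' : toFun 1 = 1

namespace ImplementerSection

variable {ρ}

/-- a section is used as a function `g ↦ r(g)`. [folklore] -/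
instance : CoeFun (ImplementerSection ρ) fun _ => symplecticGroup B → (S ≃ₗ[k] S) := ⟨ImplementerSection.toFun⟩

/-- `r(g)` implements `g`. [cite: MoeglinVignerasWaldspurger1987, Chap. 2 II.1 (A)] -/
theorem implements (r : ImplementerSection ρ) (g : symplecticGroup B) : Implements ρ (ofSymplectic B g) (r g) :=
  r.implements' g

/-- `r(1) = 1`. [folklore] -/
@[simp] theorem map_one (r : ImplementerSection ρ) : r 1 = 1 := r.map_one'

/-- `(g, r(g)) ∈ S̃p_ψ`. [cite: MoeglinVignerasWaldspurger1987, Chap. 2 II.1 (A)] -/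
theorem mem_MpPsi (r : ImplementerSection ρ) (g : symplecticGroup B) : (g, r g) ∈ MpPsi ρ := r.implements g

variable (ρ) in
open scoped Classical in
/-- **a normalised section exists as soon as implementers exist**: `r(1) = 1`, `r(g)` = some implementer otherwise.
[cite: MoeglinVignerasWaldspurger1987, Chap. 2 II.1 (A)] -/
def ofExists (hE : ExistsImplementer ρ) : ImplementerSection ρ where
  toFun g := if g = 1 then 1 else Classical.choose (hE g)
  implements' g := by
    split_ifs with hg
    · rw [hg, _root_.map_one]; exact Implements.one ρ
    · exact Classical.choose_spec (hE g)
  map_one' := if_pos rfl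

/-! ## §2 The cocycle of a section (uniqueness up to scalars) -/

variable (r : ImplementerSection ρ)

/-- a vector not killed by `r(g)`: any non-zero vector. [folklore] -/
theorem apply_ne_zero {f : S} (hf : f ≠ 0) (g : symplecticGroup B) : r g f ≠ 0 :=
  fun h => hf ((r g).map_eq_zero_iff.1 h)

/-- `r(1) = 1` in `End_k(S)`. [folklore] -/
theorem coe_map_one : ((r 1 : S ≃ₗ[k] S) : Module.End k S) = 1 := by
  rw [r.map_one]
  rfl

/-- scalars commute with the `r(g)`. [folklore] -/
theorem commute_unitScalar (a : kˣ) (g : symplecticGroup B) : Commute (unitScalar k S a) (r g : Module.End k S) :=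
  HeisenbergGroup.commute_unitScalar k S a _

variable (hU : ImplementerUniqueUpToScalar ρ)
include hU

/-- for each `g, g'` there is a unit `c` with `r(g) r(g') = c · r(gg')` (both implement `gg'`).
[cite: MoeglinVignerasWaldspurger1987, Chap. 2 II.1] -/
theorem exists_mul_eq_smul (g g' : symplecticGroup B) : ∃ c : kˣ, ∀ f, (r g * r g') f = (c : k) • r (g * g') f := by
  refine hU (g * g') _ _ (r.implements (g * g')) ?_
  rw [map_mul]
  exact Implements.mul ρ (r.implements g) (r.implements g')

/-- **the cocycle function** `c_r(g,g')` of the section. [cite: MoeglinVignerasWaldspurger1987, Chap. 2 II.1] -/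
def cocycleFun (g g' : symplecticGroup B) : kˣ :=
  Classical.choose (r.exists_mul_eq_smul hU g g')

/-- **`r(g) (r(g') f) = c_r(g,g') • r(gg') f`**. [cite: MoeglinVignerasWaldspurger1987, Chap. 2 II.1] -/
theorem mul_apply (g g' : symplecticGroup B) (f : S) : r g (r g' f) = (r.cocycleFun hU g g' : k) • r (g * g') f := by
  rw [← LinearEquiv.mul_apply]
  exact Classical.choose_spec (r.exists_mul_eq_smul hU g g') f

variable [Nontrivial S]

/-- the scalar in `r(g) r(g') = c · r(gg')` is unique (`S ≠ 0`). [folklore] -/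
theorem cocycleFun_unique {g g' : symplecticGroup B} {c : kˣ} (hc : ∀ f, r g (r g' f) = (c : k) • r (g * g') f) :
    c = r.cocycleFun hU g g' := by
  obtain ⟨f₀, hf₀⟩ := exists_ne (0 : S)
  have h := hc f₀
  rw [r.mul_apply hU] at h
  exact (Units.val_injective (smul_left_injective k (r.apply_ne_zero hf₀ _) h)).symm

/-- normalisation `c_r(1,g) = 1`. [folklore] -/
theorem cocycleFun_one_left (g : symplecticGroup B) : r.cocycleFun hU 1 g = 1 := by
  refine (r.cocycleFun_unique hU fun f => ?_).symm
  rw [Units.val_one, one_smul, one_mul, r.map_one]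
  rfl

/-- normalisation `c_r(g,1) = 1`. [folklore] -/
theorem cocycleFun_one_right (g : symplecticGroup B) : r.cocycleFun hU g 1 = 1 := by
  refine (r.cocycleFun_unique hU fun f => ?_).symm
  rw [Units.val_one, one_smul, mul_one, r.map_one]
  rfl

/-- **the 2-cocycle identity** `c(g₁,g₂) c(g₁g₂,g₃) = c(g₁,g₂g₃) c(g₂,g₃)` — associativity of composition, read on a
non-zero vector. [cite: MoeglinVignerasWaldspurger1987, Chap. 2 II.1] -/
theorem cocycleFun_cocycle (g₁ g₂ g₃ : symplecticGroup B) :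
    r.cocycleFun hU g₁ g₂ * r.cocycleFun hU (g₁ * g₂) g₃ = r.cocycleFun hU g₁ (g₂ * g₃) * r.cocycleFun hU g₂ g₃ := by
  obtain ⟨f₀, hf₀⟩ := exists_ne (0 : S)
  set c := r.cocycleFun hU with hc
  have e1 : r g₁ (r g₂ (r g₃ f₀)) = ((c g₂ g₃ : k) * (c g₁ (g₂ * g₃) : k)) • r (g₁ * g₂ * g₃) f₀ := by
    rw [r.mul_apply hU g₂ g₃, LinearEquiv.map_smul, r.mul_apply hU g₁ (g₂ * g₃), smul_smul, mul_assoc]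
  have e2 : r g₁ (r g₂ (r g₃ f₀)) = ((c g₁ g₂ : k) * (c (g₁ * g₂) g₃ : k)) • r (g₁ * g₂ * g₃) f₀ := by
    rw [r.mul_apply hU g₁ g₂, r.mul_apply hU (g₁ * g₂) g₃, smul_smul]
  rw [e2] at e1
  have h := smul_left_injective k (r.apply_ne_zero hf₀ _) e1
  exact Units.val_injective (by simpa only [Units.val_mul, mul_comm] using h)

/-- **the cocycle of the section** as a normalised central 2-cocycle on `Sp(V,B)` with values in `kˣ` (tree
`CentralCocycle`; for the Schrödinger model of a local field this is the metaplectic cocycle of the chosen section,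
Rao's for Rao's normalisation). [cite: MoeglinVignerasWaldspurger1987, Chap. 2 II.1] -/
def cocycle : CentralCocycle (symplecticGroup B) kˣ where
  toFun := r.cocycleFun hU
  cocycle' := r.cocycleFun_cocycle hU
  map_one_one' := r.cocycleFun_one_left hU 1

/-- unfolding. [folklore] -/
@[simp] theorem cocycle_apply (g g' : symplecticGroup B) : r.cocycle hU g g' = r.cocycleFun hU g g' := rfl

/-- `c_r(1,g) = 1`. [folklore] -/
theorem cocycle_one_left (g : symplecticGroup B) : r.cocycle hU 1 g = 1 := r.cocycleFun_one_left hU g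

/-- `c_r(g,1) = 1`. [folklore] -/
theorem cocycle_one_right (g : symplecticGroup B) : r.cocycle hU g 1 = 1 := r.cocycleFun_one_right hU g

/-- **criterion for `c_r(g,g') = 1`**: `r(gg') = r(g) r(g')`. [folklore] -/
theorem cocycle_eq_one_iff (g g' : symplecticGroup B) : r.cocycle hU g g' = 1 ↔ r (g * g') = r g * r g' := by
  constructor
  · intro h
    ext f
    rw [LinearEquiv.mul_apply, r.mul_apply hU, ← cocycle_apply, h, Units.val_one, one_smul]
  · intro h
    refine (r.cocycleFun_unique hU fun f => ?_).symm
    rw [Units.val_one, one_smul, h, LinearEquiv.mul_apply]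

/-! ## §3 The operator vocabulary: multiplier, Weil representation of the twisted product -/

/-- **`r(g) ∘ r(g') = c_r(g,g') • r(gg')`** as linear maps. [cite: MoeglinVignerasWaldspurger1987, Chap. 2 II.1] -/
theorem comp_eq_smul (g g' : symplecticGroup B) :
    (r g : S →ₗ[k] S) ∘ₗ (r g' : S →ₗ[k] S) = (r.cocycle hU g g' : k) • (r (g * g') : S →ₗ[k] S) := by
  refine LinearMap.ext fun f => ?_
  rw [LinearMap.comp_apply, LinearMap.smul_apply, LinearEquiv.coe_coe, LinearEquiv.coe_coe, LinearEquiv.coe_coe]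
  exact r.mul_apply hU g g' f

/-- **multiplier relation in the tree's shape**: `TwistedProduct.HasMultiplier c_r (unitScalar k S) r` in `End_k(S)`.
[cite: MoeglinVignerasWaldspurger1987, Chap. 2 II.1] -/
theorem hasMultiplier :
    TwistedProduct.HasMultiplier (r.cocycle hU) (unitScalar k S) fun g => (r g : Module.End k S) := by
  intro g g'
  refine LinearMap.ext fun f => ?_
  rw [Module.End.mul_apply, Module.End.mul_apply, unitScalar_apply, LinearEquiv.coe_coe, LinearEquiv.coe_coe,
    LinearEquiv.coe_coe]
  exact r.mul_apply hU g g' f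

/-- **the Weil representation of the twisted product `Sp(V,B) ×_{c_r} kˣ` on `S`**: `(g, a) ↦ a · r(g)`, a genuine
homomorphism into `End_k(S)` (tree `TwistedProduct.opHom`). [cite: MoeglinVignerasWaldspurger1987, Chap. 2 II.1] -/
def weilOp : TwistedProduct (r.cocycle hU) →* Module.End k S :=
  TwistedProduct.opHom (r.hasMultiplier hU) r.coe_map_one (r.commute_unitScalar)

/-- formula `weilOp (g, a) f = a • r(g) f`. [cite: MoeglinVignerasWaldspurger1987, Chap. 2 II.1] -/
theorem weilOp_apply (x : TwistedProduct (r.cocycle hU)) (f : S) : r.weilOp hU x f = (x.a : k) • r x.g f := rfl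

/-- on the central `kˣ` the Weil representation is the scalar action. [folklore] -/
theorem weilOp_inl (a : kˣ) : r.weilOp hU (TwistedProduct.inl _ a) = unitScalar k S a :=
  TwistedProduct.opHom_inl _ _ _ a

/-- on the section `sec(g) = (g,1)` the Weil representation is `r(g)`. [folklore] -/
theorem weilOp_sec (g : symplecticGroup B) : r.weilOp hU (TwistedProduct.sec _ g) = (r g : Module.End k S) :=
  TwistedProduct.opHom_sec _ _ _ g

/-- **a subgroup on which `r` is multiplicative splits into the twisted product** with `β = 1`
(`TwistedProduct.IsSplitting`). [cite: MoeglinVignerasWaldspurger1987, Chap. 2 II.10] -/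
theorem isSplitting_of_mul (K : Subgroup (symplecticGroup B)) (hK : ∀ g ∈ K, ∀ g' ∈ K, r (g * g') = r g * r g') :
    TwistedProduct.IsSplitting (r.cocycle hU) K.subtype fun _ => 1 :=
  TwistedProduct.isSplitting_one_iff.2 fun g g' => (r.cocycle_eq_one_iff hU g g').2 (hK g g.2 g' g'.2)

end ImplementerSection

/-! ## §4 The tautological representation of `S̃p_ψ` on `S` -/

/-- **the tautological (Weil) representation of `S̃p_ψ = MpPsi ρ` on `S`**: `(g, M) ↦ M` — the local Weil representation
as an honest representation of the tautological metaplectic-type group (the `r v` a restricted tensor product over the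
groups `G v = S̃p_{ψ_v}` consumes). [cite: MoeglinVignerasWaldspurger1987, Chap. 2 II.1] -/
def MpPsi.toRep : Representation k (MpPsi ρ) S :=
  (LinearEquiv.automorphismGroup.toLinearMapMonoidHom).comp (MpPsi.toOp ρ)

/-- formula: `MpPsi.toRep ρ p f = p.2 f`. [folklore] -/
@[simp] theorem MpPsi.toRep_apply (p : MpPsi ρ) (f : S) : MpPsi.toRep ρ p f = (p : symplecticGroup B × (S ≃ₗ[k] S)).2 f :=
  rfl

/-- the tautological representation implements: `toRep p (ρ h f) = ρ (p.1 • h) (toRep p f)`. [cite: MoeglinVignerasWaldspurger1987, Chap. 2 II.1 (A)] -/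
theorem MpPsi.toRep_implements (p : MpPsi ρ) :
    Implements ρ (ofSymplectic B (p : symplecticGroup B × (S ≃ₗ[k] S)).1) (MpPsi.toOp ρ p) :=
  p.2

/-- two implementers of the same `g` that agree on a vector not killed by one of them are equal (uniqueness up to a
scalar, and the scalar is `1`). [cite: MoeglinVignerasWaldspurger1987, Chap. 2 II.1] -/
theorem implementer_eq_of_apply_eq (hU : ImplementerUniqueUpToScalar ρ) {g : symplecticGroup B} {M M' : S ≃ₗ[k] S}
    (hM : Implements ρ (ofSymplectic B g) M) (hM' : Implements ρ (ofSymplectic B g) M')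
    {f₀ : S} (hf₀ : M f₀ ≠ 0) (he : M' f₀ = M f₀) : M' = M := by
  obtain ⟨c, hc⟩ := hU g M M' hM hM'
  have hc1 : (c : k) = 1 := by
    have h := hc f₀
    rw [he] at h
    exact (smul_left_injective k hf₀ (show (1 : k) • M f₀ = (c : k) • M f₀ by rw [one_smul]; exact h)).symm
  ext f
  rw [hc f, hc1, one_smul]

end Literature.RepresentationTheory.HeisenbergGroup
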